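import Literature.Geometry.ComplexAnalytic.PhamBrieskornFibreRotationSum
import Literature.AlgebraicGeometry.HodgeTheory.CyclicVectorIndependent
import HarnessLib

/-!
# The vanishing homology of the cyclic node is a CYCLIC `ℚ[τ]`-module: `H₂(F; ℚ) = ℚ[τ]·δ ≅ ℚ(ζ_p)` for every
# `δ ≠ 0` (Carlson–Toledo 1999 §6: "`V = ℚ[τ]δ`, `(k−1)`-dimensional"; Milnor 1968 Thm. 9.1)

For the local model `F = {z₀² + z₁² + z₂^p = 1}` (`p` prime) of the `A_{p−1}` point of a `p`-cyclic cover of the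
plane branched along a one-nodal curve, and the covering rotation `τ = (rotateFibre ζ)_*` of a primitive `p`-th root
of unity `ζ` on `H₂(F; ℚ)`:

* `map_rotateFibre_pow_prime_eq_one` — `τ^p = 1`;
* **`span_pow_map_rotateFibre_eq_top`** — for every `δ ≠ 0`, the translates `δ, τδ, τ²δ, …` SPAN `H₂(F; ℚ)`:
  `δ, …, τ^{p−2}δ` are linearly independent (`CyclicVectorIndependent.linearIndependent_pow_apply_of_sum_eq_zero`,
  from `Σ_{i<p} τ^i δ = 0` — `PhamBrieskornFibreRotationSum.sum_pow_map_rotateFibre_eq_zero` — and the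
  irreducibility of the cyclotomic polynomial), so their span has dimension `p − 1 = dim_ℚ H₂(F; ℚ)`
  (`finrank_rat_singularHomology_fibre_cyclicNode`).

This is the local form of the clauses `δ ≠ 0`, `Σ_{i<p} τ^i δ = 0`, `dim ℚ[τ]δ = p − 1` of the cited
Picard–Lefschetz fact `carlsonToledo1999_nodalMeridianMonodromy_isCyclicReflection` (crux K1 of route
`Summits/HodgeConjecture/HodgeConjecture/Theses/CyclicUnitaryPowers.lean`): ANY non-zero local vanishing class
generates the vanishing homology under the covering group. Everything is proved; no definition, no named fact.

## References

* [CarlsonToledo1999] J. A. Carlson, D. Toledo, Duke Math. J. 97 (1999), §6 (held text p0013–p0014).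
* [Milnor1968] J. Milnor, Singular Points of Complex Hypersurfaces, Ann. of Math. Studies 61 (1968), §9 Thm. 9.1.
-/

noncomputable section

open Complex ContinuousMap Set Filter CategoryTheory Limits
open Literature.AlgebraicTopology.SingularHomology
open Literature.AlgebraicGeometry.HodgeTheory
open scoped unitInterval Topology

namespace Literature.Geometry.ComplexAnalytic

namespace PhamBrieskorn

section CyclicModule

variable (F : Type) [Field F] {n : ℕ} {a : Fin (n + 2) → ℕ} (ha : ∀ i, a i ≠ 0)

/-- **`τ^m = 1`** for the rotation by an `m`-th root of unity `ζ` (`m = aₙ₊₁`) on `Hₙ₊₁(F)`.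
[cite: Milnor1968, §9 p. 77] -/
theorem map_rotateFibre_pow_eq_one (ζ : Omega (a (Fin.last (n + 1)))) :
    (singularHomology.map F F (rotateFibre a ha ζ : C(fibre a, fibre a)) (n + 1)).hom ^ (a (Fin.last (n + 1))) = 1 := by
  rw [map_rotateFibre_pow]
  have h1 : (⟨(ζ : ℂ) ^ (a (Fin.last (n + 1))), by
      rw [mem_Omega, ← pow_mul, mul_comm, pow_mul, (mem_Omega.1 ζ.2), one_pow]⟩ : Omega (a (Fin.last (n + 1)))) =
      ⟨1, one_mem_Omega _⟩ := Subtype.ext (mem_Omega.1 ζ.2)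
  rw [h1, rotateFibre_one, singularHomology.map_id]
  rfl

end CyclicModule

section CyclicNode

variable {p : ℕ}

/-- **The vanishing homology of the cyclic node is cyclic: every non-zero class generates `H₂(F; ℚ)` under the
covering rotation.** For `p` prime, `ζ` a primitive `p`-th root of unity, `τ = (rotateFibre ζ)_*` on
`H₂({z₀² + z₁² + z₂^p = 1}; ℚ)` and `δ ≠ 0`: `span_ℚ {τ^i δ : i ∈ ℕ} = H₂(F; ℚ)` (`δ, …, τ^{p−2}δ` are independent
and `dim_ℚ H₂ = p − 1`). [cite: CarlsonToledo1999, §6 (held text p0013)] [cite: Milnor1968, §9 Thm. 9.1] -/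
theorem span_pow_map_rotateFibre_eq_top (hp : p.Prime) {ζ : ℂ} (hζ : IsPrimitiveRoot ζ p)
    (δ : singularHomology ℚ ℚ (fibre (cyclicNodeExponents p)) 2) (hδ : δ ≠ 0) :
    Submodule.span ℚ (Set.range fun i : ℕ =>
      ((singularHomology.map ℚ ℚ (rotateFibre (cyclicNodeExponents p) (cyclicNodeExponents_ne_zero p hp.ne_zero)
        ⟨ζ, hζ.pow_eq_one⟩ : C(fibre (cyclicNodeExponents p), fibre (cyclicNodeExponents p))) 2).hom ^ i) δ) = ⊤ := by
  set τ := (singularHomology.map ℚ ℚ (rotateFibre (cyclicNodeExponents p) (cyclicNodeExponents_ne_zero p hp.ne_zero)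
    ⟨ζ, hζ.pow_eq_one⟩ : C(fibre (cyclicNodeExponents p), fibre (cyclicNodeExponents p))) 2).hom with hτ
  have hsum : ∑ i ∈ Finset.range p, (τ ^ i) δ = 0 :=
    sum_pow_map_rotateFibre_eq_zero ℚ (cyclicNodeExponents_ne_zero p hp.ne_zero) hζ δ
  have hτp : τ ^ p = 1 := map_rotateFibre_pow_eq_one ℚ (cyclicNodeExponents_ne_zero p hp.ne_zero) ⟨ζ, hζ.pow_eq_one⟩
  have hind := linearIndependent_pow_apply_of_sum_eq_zero (τ := τ) hp hδ hsum
  haveI : Module.Finite ℚ (singularHomology ℚ ℚ (fibre (cyclicNodeExponents p)) 2) := by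
    refine Module.finite_of_finrank_pos ?_
    rw [finrank_rat_singularHomology_fibre_cyclicNode p hp.ne_zero]
    have := hp.two_le; omega
  rw [span_pow_apply_eq hp.two_le hτp hsum]
  apply Submodule.eq_top_of_finrank_eq
  rw [finrank_span_eq_card hind, Fintype.card_fin, finrank_rat_singularHomology_fibre_cyclicNode p hp.ne_zero]

end CyclicNode

end PhamBrieskorn

end Literature.Geometry.ComplexAnalytic

end
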